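import Summits.Ventures.PercRepro.RankLevelSetLevelElevenGXTFormZA
import Summits.Ventures.PercRepro.RankLevelSetLevelElevenGXTFormZB
import Summits.Ventures.PercRepro.RankLevelSetLevelElevenGXTFormZC
import Summits.Ventures.PercRepro.RankLevelSetLevelElevenGXTFormZD
import Summits.Ventures.PercRepro.RankLevelSetLevelElevenGXTFormZE
import Summits.Ventures.PercRepro.RankLevelSetLevelElevenGXTFormZF
import Summits.Ventures.PercRepro.RankLevelSetLevelElevenGXTFormZG
import Summits.Ventures.PercRepro.RankLevelSetLevelElevenGXTFormZH
import Summits.Ventures.PercRepro.RankLevelSetLevelElevenGXTFormZI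
import Summits.Ventures.PercRepro.RankLevelSetLevelElevenGXTFormZJ
import Summits.Ventures.PercRepro.RankLevelSetLevelElevenGXTFormZK
import Summits.Ventures.PercRepro.RankLevelSetLevelElevenGXTFormZL
import Summits.Ventures.PercRepro.RankLevelSetLevelElevenGXTFormZM
import Summits.Ventures.PercRepro.RankLevelSetLevelElevenGXTFormZN
import Summits.Ventures.PercRepro.RankLevelSetLevelElevenGXTFormZO
import Summits.Ventures.PercRepro.RankLevelSetLevelElevenGXTFormZP
import Summits.Ventures.PercRepro.RankLevelSetLevelElevenGXTFormZQ
import Summits.Ventures.PercRepro.RankLevelSetLevelElevenGXTFormZR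

/-!
# PercRepro — THE LEVEL-`11` DISPATCHER OF THE GXT CHAIN (THE GIANT-EXACT COUNT WITH LEMMA T5) AT BASE `865`: the per-corank form
`(c₁, c₂)`, `(P_d^gxt)` and the `Y`-tail for `12 ≤ d ≤ 1387` (p2, gen 36; a feeder for S4 — the top of the `q = 11` window, from
`1,554`). The 18 parts ZA … ZR. Axioms: standard.
-/

set_option exponentiation.threshold 4096

namespace PercRepro

namespace ThmN

/-- **THE PER-CORANK FORM OF THE LEVEL-`11` GXT CHAIN AT BASE `865`**: for every corank `12 ≤ d ≤ 1387`, every `p ≥ 865` and every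
`n ≥ 865 + d` there are `0 < c₂ < c₁` with the certificate `c₁·(C(n,11) + σ_m·Π_E′ + 2^{min 1279 (11+d)}) ≤ c₂·2^{d−11}·C(p+11, 11)` and
the tail `c₁·G₁₁(d, n) ≤ (c₁ − c₂)·2^n` (the form `(c₁, c₂)` of every corank in FORMS11GXT_865.txt, lane tools/; LEMMA T5 in `Π_E`). -/
theorem gxt_form_eleven (d : ℕ) (hd1 : 12 ≤ d) (hd2 : d ≤ 1387) (p : ℕ) (hp : 865 ≤ p) (n : ℕ) (hn : 865 + d ≤ n) :
    ∃ c₁ c₂ : ℕ, 0 < c₂ ∧ c₂ < c₁ ∧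
    ((c₁ : ℕ) : ℚ) * ((((p + d).choose 11 : ℕ) : ℚ) + (∑ j ∈ Finset.range (min (d - 11) 60), ((Nat.choose (min 1267 (max ((d + min 629 d) / 2 + 1) (min 628 (d - 1) + 2) - 2)) j : ℕ) : ℚ) / (((j + 1) + 3 * (j + 1).choose 2 + 3 * (j + 1).choose 3 + 2 * (j + 1).choose 4 : ℕ) : ℚ) + (if 60 < d - 11 then (66 / 5 : ℚ) * 2 ^ (min 1267 (max ((d + min 629 d) / 2 + 1) (min 628 (d - 1) + 2) - 2) + 4) / ((((min 1267 (max ((d + min 629 d) / 2 + 1) (min 628 (d - 1) + 2) - 2)) + 1) * ((min 1267 (max ((d + min 629 d) / 2 + 1) (min 628 (d - 1) + 2) - 2)) + 2) * ((min 1267 (max ((d + min 629 d) / 2 + 1) (min 628 (d - 1) + 2) - 2)) + 3) * ((min 1267 (max ((d + min 629 d) / 2 + 1) (min 628 (d - 1) + 2) - 2)) + 4) : ℕ) : ℚ) else 0)) *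
      (((d * (d + 1) / 2 : ℕ) : ℚ) * ((p + d).choose 9 : ℚ) + ((d * (d + 1) * (d + 2) / 3 : ℕ) : ℚ) * ((p + d).choose 8 : ℚ) + ((7 * d * (d + 1) * (d + 2) * (d + 3) / 48 : ℕ) : ℚ) * ((p + d).choose 7 : ℚ) + (((d + 5).choose 6 : ℕ) : ℚ) * ((p + d).choose 6 : ℚ) + (((d + 6).choose 7 : ℕ) : ℚ) * ((p + d).choose 5 : ℚ) + (((d + 7).choose 8 : ℕ) : ℚ) * ((p + d).choose 4 : ℚ) + (((d + 8).choose 9 : ℕ) : ℚ) * ((p + d).choose 3 : ℚ) + (((d + 9).choose 10 : ℕ) : ℚ) * ((p + d).choose 2 : ℚ) + (((d + 10).choose 11 : ℕ) : ℚ) * (p + d : ℚ) + (((d + 11).choose 12 : ℕ) : ℚ)) +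
      (2 : ℚ) ^ (min 1279 (11 + d))) ≤
      ((c₂ : ℕ) : ℚ) * 2 ^ (d - 11) * (((p + 11).choose 11 : ℕ) : ℚ) ∧
      c₁ * (n.choose 11 * 2 ^ (min 1268 d) + n.choose 10 * 2 ^ 629 + n.choose 9 * 2 ^ 310 + n.choose 8 * 2 ^ 151 + n.choose 7 * 2 ^ 72 + n.choose 6 * 2 ^ 33 + n.choose 5 * 2 ^ 14 + n.choose 4 * 2 ^ 6 + n.choose 3 * 2 ^ 3 + n.choose 2 * 2 + n + 1 + ∑ j ∈ Finset.range (d + 1), n.choose j) ≤ (c₁ - c₂) * 2 ^ n := by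
  rcases Nat.lt_or_ge d (91 + 1) with h0 | h0
  · exact gxt_form_eleven_ZA d hd1 (by omega) p hp n hn
  rcases Nat.lt_or_ge d (171 + 1) with h1 | h1
  · exact gxt_form_eleven_ZB d (by omega) (by omega) p hp n hn
  rcases Nat.lt_or_ge d (251 + 1) with h2 | h2
  · exact gxt_form_eleven_ZC d (by omega) (by omega) p hp n hn
  rcases Nat.lt_or_ge d (331 + 1) with h3 | h3
  · exact gxt_form_eleven_ZD d (by omega) (by omega) p hp n hn
  rcases Nat.lt_or_ge d (411 + 1) with h4 | h4
  · exact gxt_form_eleven_ZE d (by omega) (by omega) p hp n hn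
  rcases Nat.lt_or_ge d (491 + 1) with h5 | h5
  · exact gxt_form_eleven_ZF d (by omega) (by omega) p hp n hn
  rcases Nat.lt_or_ge d (571 + 1) with h6 | h6
  · exact gxt_form_eleven_ZG d (by omega) (by omega) p hp n hn
  rcases Nat.lt_or_ge d (651 + 1) with h7 | h7
  · exact gxt_form_eleven_ZH d (by omega) (by omega) p hp n hn
  rcases Nat.lt_or_ge d (731 + 1) with h8 | h8
  · exact gxt_form_eleven_ZI d (by omega) (by omega) p hp n hn
  rcases Nat.lt_or_ge d (811 + 1) with h9 | h9
  · exact gxt_form_eleven_ZJ d (by omega) (by omega) p hp n hn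
  rcases Nat.lt_or_ge d (891 + 1) with h10 | h10
  · exact gxt_form_eleven_ZK d (by omega) (by omega) p hp n hn
  rcases Nat.lt_or_ge d (971 + 1) with h11 | h11
  · exact gxt_form_eleven_ZL d (by omega) (by omega) p hp n hn
  rcases Nat.lt_or_ge d (1051 + 1) with h12 | h12
  · exact gxt_form_eleven_ZM d (by omega) (by omega) p hp n hn
  rcases Nat.lt_or_ge d (1131 + 1) with h13 | h13
  · exact gxt_form_eleven_ZN d (by omega) (by omega) p hp n hn
  rcases Nat.lt_or_ge d (1211 + 1) with h14 | h14
  · exact gxt_form_eleven_ZO d (by omega) (by omega) p hp n hn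
  rcases Nat.lt_or_ge d (1291 + 1) with h15 | h15
  · exact gxt_form_eleven_ZP d (by omega) (by omega) p hp n hn
  rcases Nat.lt_or_ge d (1371 + 1) with h16 | h16
  · exact gxt_form_eleven_ZQ d (by omega) (by omega) p hp n hn
  · exact gxt_form_eleven_ZR d (by omega) hd2 p hp n hn

end ThmN

end PercRepro
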